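import Literature.Dynamics.TopologicalDynamics.ExpansiveEntropyFixedScale
import Mathlib.Dynamics.TopologicalEntropy.NetEntropy
import HarnessLib

/-!
# `h(T) = s(δ₀, T)`: for an expansive map the entropy is also attained by SEPARATED sets at a fixed scale
# (Walters Thm 7.11 (ii), the `s`-half; Brin–Stuck Prop. 2.5.7 with Lemma 2.5.1)

Layer `Literature/Dynamics/TopologicalDynamics`, namespace `Literature.Dynamics.TopologicalDynamics.ExpansiveEntropy`.
Rider to `ExpansiveEntropyFixedScale.lean` (`h(T; F) = r`-entropy at every entourage below a separating one, Mathlib's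
`coverEntropyEntourage`): the same for Mathlib's net (separated-set) entropy `netEntropyEntourage`, squeezed by Mathlib's
`coverEntropyEntourage T F (D ○ D) ≤ netEntropyEntourage T F D ≤ coverEntropy T F`.  Written for lane `lit-hodgefound`
(prover seat `lit-hodgefound-p31`).

## The printed statements

P. Walters, *An Introduction to Ergodic Theory* (GTM 79, 1982; held `book:walters1982-introduction-ergodic-theory`), §7.2
**Theorem 7.11 (ii)** (chunk p0185) «If `δ` is an expansive constant for `T` then `h(T) = r(δ₀, T) = s(δ₀, T)` for all
`δ₀ < δ/4`.» with its proof (chunk p0186: «`h(T, α) ≤ r(δ₀, X) ≤ s(δ₀, X) ≤ h(T)`»), Definition 7.11 / Remark (12)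
(chunks p0177–p0178: `(n, ε)`-separated sets, `s_n(ε, K)`, `r_n(ε, K) ≤ s_n(ε, K) ≤ r_n(ε/2, K)`).  M. Brin, G. Stuck,
*Introduction to Dynamical Systems* (2002; held), §2.5 Lemma 2.5.1 (chunk p0041: `cov(n, 2ε, f) ≤ sep(n, ε, f) ≤
span(n, ε, f)`) and **Proposition 2.5.7** (chunk p0042) «`h(f) = h_ε(f)` for any `ε < δ`».

## What is formalised (theorems only; no definition, no named fact)

* **`coverEntropy_eq_netEntropyEntourage`** — positively expansive continuous `T` on a compact uniform space, `E` a
  separating entourage: `h(T; F) = netEntropyEntourage T F D` for every reflexive symmetric entourage `D` with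
  `closure (D ○ D) ⊆ E`; **`coverEntropy_univ_eq_netEntropyEntourage_of_inverse`** — the same for an expansive
  homeomorphism (two-sided separation through the inverse `S`), `F = X`;
* metric forms with an expansiveness constant `δ`: **`coverEntropy_eq_netEntropyEntourage_ball`** (`h(f; F) = s_ε(f; F)`
  for `0 < ε`, `2ε < δ`, positively expansive) and **`coverEntropy_univ_eq_netEntropyEntourage_ball_of_inverse`**
  (expansive homeomorphism) — Walters' `h(T) = s(δ₀, T)` (he takes `δ₀ < δ/4`).

## References

* [Walters1982] P. Walters, *An Introduction to Ergodic Theory*, GTM 79 (1982), §7.2 Definition 7.11, Remark (12),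
  Theorem 7.11 (ii) with proof (held text chunks p0177–p0178, p0185–p0186).
* [BrinStuck2002] M. Brin, G. Stuck, *Introduction to Dynamical Systems*, CUP (2002), §2.5 Lemma 2.5.1, Proposition 2.5.7
  (held text chunks p0041–p0042).
-/

open Set Function Filter Topology Dynamics UniformSpace
open scoped Uniformity SetRel

namespace Literature.Dynamics.TopologicalDynamics.ExpansiveEntropy

variable {X : Type*}

section Uniform

variable [UniformSpace X] [CompactSpace X] {T S : X → X}

/-- **Walters Thm 7.11 (ii), `h(T) = s(δ₀, T)`, for a positively expansive map**: if `E` separates forward orbits of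
the continuous map `T` of a compact uniform space, then for every reflexive symmetric entourage `D` with
`closure (D ○ D) ⊆ E` the entropy `h(T; F)` equals Mathlib's net entropy `netEntropyEntourage T F D` (growth rate of
maximal `(D, n)`-separated sets) — `h = h^{cov}_{D ○ D} ≤ s_D ≤ h`.
[cite: Walters1982, §7.2 Theorem 7.11 (ii) with proof and Remark (12) (held text chunks p0178, p0185–p0186)]
[cite: BrinStuck2002, §2.5 Lemma 2.5.1 and Proposition 2.5.7 (held text chunks p0041–p0042)] -/
theorem coverEntropy_eq_netEntropyEntourage (hT : Continuous T) {E : SetRel X X}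
    (hexp : ∀ x y, (∀ k : ℕ, (T^[k] x, T^[k] y) ∈ E) → x = y) {D : SetRel X X} [D.IsRefl] [D.IsSymm]
    (hDu : D ∈ 𝓤 X) (hDE : closure (D ○ D : Set (X × X)) ⊆ E) (F : Set X) :
    coverEntropy T F = netEntropyEntourage T F D := by
  have hDD : (D ○ D) ∈ 𝓤 X := Filter.mem_of_superset hDu SetRel.left_subset_comp
  refine le_antisymm ?_ (netEntropyEntourage_le_coverEntropy T F hDu)
  rw [coverEntropy_eq_coverEntropyEntourage hT hexp hDD hDE F]
  exact coverEntropyEntourage_le_netEntropyEntourage T F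

/-- **Walters Thm 7.11 (ii), `h(T) = s(δ₀, T)`, for an expansive homeomorphism** (`S = T⁻¹`, `E` separating two-sided
orbits): `h(T) = netEntropyEntourage T univ D` for every reflexive symmetric entourage `D` with `closure (D ○ D) ⊆ E`.
[cite: Walters1982, §7.2 Theorem 7.11 (ii) with proof (held text chunks p0185–p0186)]
[cite: BrinStuck2002, §2.5 Lemma 2.5.1 and Proposition 2.5.7 (held text chunks p0041–p0042)] -/
theorem coverEntropy_univ_eq_netEntropyEntourage_of_inverse (hT : Continuous T) (hS : Continuous S)
    (hST : LeftInverse S T) (hTS : RightInverse S T) {E : SetRel X X}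
    (hexp : ∀ x y, (∀ k : ℕ, (T^[k] x, T^[k] y) ∈ E) → (∀ k : ℕ, (S^[k] x, S^[k] y) ∈ E) → x = y)
    {D : SetRel X X} [D.IsRefl] [D.IsSymm] (hDu : D ∈ 𝓤 X) (hDE : closure (D ○ D : Set (X × X)) ⊆ E) :
    coverEntropy T univ = netEntropyEntourage T univ D := by
  have hDD : (D ○ D) ∈ 𝓤 X := Filter.mem_of_superset hDu SetRel.left_subset_comp
  refine le_antisymm ?_ (netEntropyEntourage_le_coverEntropy T univ hDu)
  rw [coverEntropy_univ_eq_coverEntropyEntourage_of_inverse hT hS hST hTS hexp hDD hDE]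
  exact coverEntropyEntourage_le_netEntropyEntourage T univ

end Uniform

section Metric

variable [MetricSpace X] [CompactSpace X] {T S : X → X}

omit [CompactSpace X] in
/-- The open `ε`-ball entourage is reflexive for `ε > 0`. [folklore] -/
private theorem isRefl_ball {ε : ℝ} (hε : 0 < ε) : SetRel.IsRefl {p : X × X | dist p.1 p.2 < ε} :=
  ⟨fun x ↦ show dist x x < ε by rwa [dist_self]⟩

omit [CompactSpace X] in
/-- The open `ε`-ball entourage is symmetric. [folklore] -/
private theorem isSymm_ball (ε : ℝ) : SetRel.IsSymm {p : X × X | dist p.1 p.2 < ε} :=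
  ⟨fun x y (h : dist x y < ε) ↦ show dist y x < ε by rwa [dist_comm]⟩

omit [CompactSpace X] in
/-- `closure ({d < ε} ○ {d < ε}) ⊆ {d ≤ 2ε}`. [folklore] -/
private theorem closure_ball_comp_ball_subset (ε : ℝ) :
    closure (({p : X × X | dist p.1 p.2 < ε} : SetRel X X) ○ {p : X × X | dist p.1 p.2 < ε} : Set (X × X)) ⊆
      {p : X × X | dist p.1 p.2 ≤ 2 * ε} := by
  refine closure_minimal ?_ (isClosed_le continuous_dist continuous_const)
  rintro ⟨x, z⟩ ⟨y, hxy, hyz⟩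
  change dist x y < ε at hxy
  change dist y z < ε at hyz
  change dist x z ≤ 2 * ε
  linarith [dist_triangle x y z]

/-- **`h(f; F) = s_ε(f; F)` for a positively expansive map with expansiveness constant `δ` and `0 < ε < δ/2`**
(Walters' `h(T) = s(δ₀, T)`; the scale is the open `ε`-ball, Mathlib's `netEntropyEntourage`).
[cite: Walters1982, §7.2 Theorem 7.11 (ii) (held text chunk p0185)]
[cite: BrinStuck2002, §2.5 Lemma 2.5.1 and Proposition 2.5.7 (held text chunks p0041–p0042)] -/
theorem coverEntropy_eq_netEntropyEntourage_ball (hT : Continuous T) {δ : ℝ}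
    (hexp : ∀ x y, (∀ k : ℕ, dist (T^[k] x) (T^[k] y) < δ) → x = y) {ε : ℝ} (hε : 0 < ε) (hεδ : 2 * ε < δ)
    (F : Set X) : coverEntropy T F = netEntropyEntourage T F {p : X × X | dist p.1 p.2 < ε} := by
  haveI := isRefl_ball (X := X) hε
  haveI := isSymm_ball (X := X) ε
  exact coverEntropy_eq_netEntropyEntourage hT (E := {p : X × X | dist p.1 p.2 < δ}) (fun x y hxy ↦ hexp x y hxy)
    (Metric.dist_mem_uniformity hε) (fun p hp ↦ lt_of_le_of_lt (closure_ball_comp_ball_subset ε hp) hεδ) F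

/-- **`h(f) = s_ε(f)` for an expansive homeomorphism with expansiveness constant `δ` and `0 < ε < δ/2`** (Walters Thm
7.11 (ii) as printed, `s`-half; inverse `S`). [cite: Walters1982, §7.2 Theorem 7.11 (ii) (held text chunk p0185)]
[cite: BrinStuck2002, §2.5 Lemma 2.5.1 and Proposition 2.5.7 (held text chunks p0041–p0042)] -/
theorem coverEntropy_univ_eq_netEntropyEntourage_ball_of_inverse (hT : Continuous T) (hS : Continuous S)
    (hST : LeftInverse S T) (hTS : RightInverse S T) {δ : ℝ}
    (hexp : ∀ x y, (∀ k : ℕ, dist (T^[k] x) (T^[k] y) < δ) → (∀ k : ℕ, dist (S^[k] x) (S^[k] y) < δ) → x = y)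
    {ε : ℝ} (hε : 0 < ε) (hεδ : 2 * ε < δ) :
    coverEntropy T univ = netEntropyEntourage T univ {p : X × X | dist p.1 p.2 < ε} := by
  haveI := isRefl_ball (X := X) hε
  haveI := isSymm_ball (X := X) ε
  exact coverEntropy_univ_eq_netEntropyEntourage_of_inverse hT hS hST hTS (E := {p : X × X | dist p.1 p.2 < δ})
    (fun x y hxy hxy' ↦ hexp x y hxy hxy') (Metric.dist_mem_uniformity hε)
    fun p hp ↦ lt_of_le_of_lt (closure_ball_comp_ball_subset ε hp) hεδ

end Metric

end Literature.Dynamics.TopologicalDynamics.ExpansiveEntropy
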